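import Literature.NumberTheory.Automorphic.ResGLnCohomology
import Literature.NumberTheory.Automorphic.UnramifiedLevelChange
import Literature.NumberTheory.Automorphic.BorelEigenvalueFactorisation
import HarnessLib

/-!
# The unramified Hecke operators on `H^q(S_{K_f(𝔫)}, Ẽ_λ(k))` of `Res_{K/ℚ} GL_n` commute

Topic `NumberTheory/Automorphic`; namespace `Literature.NumberTheory.Automorphic`, grouping
sub-namespace `ResGLnCohomology` (a theorems-only complement to `ResGLnCohomology.lean`: no
definition, no named fact, no instance, no `sorry`).

For a coefficient field `k`, `n : ℕ`, a number field `K`, a level `𝔫 ≠ 0` and a weight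
`λ : (K →+* k) → (Fin n → ℤ)`, the Betti receptacle
`ResGLnCohomology.levelCohomology k n K 𝔫 λ q = H^q(GL_n(K)⁺, Fun(GL_n(𝔸_K^∞)/K_f(𝔫), E_λ(k)))`
carries the double-coset Hecke operators `heckeOp … g = [K_f(𝔫) g K_f(𝔫)]` (`TwistedQuotient.heckeEnd`)
and the unramified `heckeT … v i = T_{v,i}` (`t_{v,i} = BigHeckeGLn.heckeElement n K v i`).  We prove:

* `isUnramifiedLevel_level` — `K_f(𝔫)` is unramified at every `v ∤ 𝔫` in the sense of
  `ArithmeticQuotient.IsUnramifiedLevel` (`K_f(𝔫) = K_f(𝔫)ᵛ × GL_n(𝒪_v)`): the statement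
  `BigHeckeGLn.isUnramifiedLevel_comap_principalCongruenceLevel` read through the `abbrev`
  `ResGLnCohomology.level n K 𝔫 = finitePrincipalCongruenceLevel n K 𝔫`;
* `heckeOp_ofLocal_comm` — for `v, w ∤ 𝔫`, `x ∈ GL_n(K_v)`, `y ∈ GL_n(K_w)`, the operators of
  `ιᵥ(x)` and `ι_w(y)` commute on `H^q(S_{K_f(𝔫)}, Ẽ_λ(k))`: at two different places because
  `ιᵥ(GL_n(K_v))` and `ι_w(GL_n(K_w))` commute elementwise
  (`TwistedQuotient.heckeEnd_comm_of_orthogonal`), at one place by Gelfand's trick with the transpose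
  and the `v`-adic Cartan decomposition (`ArithmeticQuotient.heckeFun_comm_of_antiInvolution`,
  `exists_glTranspose_eq_mul_mul_adicCompletion`; the commutativity of the spherical Hecke algebra,
  [Bump1997, Thm. 4.6.1]), transported to twisted group cohomology by functoriality
  (`TwistedQuotient.heckeEnd_comm_of_heckeFun_comm`).  This is the argument of
  `BigHeckeGLn.TameLevel.heckeEnd_ofLocal_comm` (the `p`-adic tower with trivial coefficients) for
  the twisted receptacle with algebraic coefficients;
* `heckeT_comm`, `commute_heckeT` — in particular the unramified `T_{v,i}`, `T_{w,j}` (`v, w ∤ 𝔫`,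
  all `i, j : ℕ`) pairwise commute (`BigHeckeGLn.heckeElement_eq_ofLocal`:
  `t_{v,i} = ιᵥ(diag(ϖ_v,…,ϖ_v,1,…,1))`) — "these operators pairwise commute"
  [GeeNewton2020, §2.1.1], here on `H^•(S_{K_f(𝔫)}, Ẽ_λ(k))`; whence the `k`-algebra they generate in
  `End_k H^q(S_{K_f(𝔫)}, Ẽ_λ(k))` is commutative (Mathlib `Algebra.isMulCommutative_adjoin`).

NOT here: operators at the places dividing `𝔫` (no commutativity is claimed there), and the
finite-dimensionality of the receptacle (`ResGLnCohomologyFiniteDimensional`, given Borel–Serre).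

## References

* D. Bump, *Automorphic forms and representations*, Cambridge (1997), Thm. 4.6.1. [Bump1997]
* T. Gee, J. Newton, *Patching and the completed homology of locally symmetric spaces*, JIMJ (2020),
  §2.1.1. [GeeNewton2020]
-/

noncomputable section

open NumberField IsDedekindDomain

namespace Literature.NumberTheory.Automorphic

namespace ResGLnCohomology

open BigHeckeGLn

variable (k : Type) [Field k] (n : ℕ) (K : Type) [Field K] [NumberField K]

variable {k} in
/-- **`K_f(𝔫)` is unramified at every `v ∤ 𝔫`** (`𝔫 ≠ 0`): `ιᵥ(GL_n(𝒪_v)) ≤ K_f(𝔫)` and the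
`v`-components of `K_f(𝔫)` are integral, i.e. `K_f(𝔫) = K_f(𝔫)ᵛ × GL_n(𝒪_v)`
(`ArithmeticQuotient.IsUnramifiedLevel`; `BigHeckeGLn.isUnramifiedLevel_comap_principalCongruenceLevel`
for the level `ResGLnCohomology.level n K 𝔫 = finitePrincipalCongruenceLevel n K 𝔫`). [folklore] -/
theorem isUnramifiedLevel_level {𝔫 : Ideal (𝓞 K)} (h𝔫 : 𝔫 ≠ 0) {v : HeightOneSpectrum (𝓞 K)}
    (hv : ¬ v.asIdeal ∣ 𝔫) :
    ArithmeticQuotient.IsUnramifiedLevel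
      (valuedCongruenceSubgroup (Fin n) (1 : WithZero (Multiplicative ℤ))) (ofLocal n K v)
      (localComponent n K v) (level n K 𝔫) :=
  isUnramifiedLevel_comap_principalCongruenceLevel h𝔫 hv

/-- **The Hecke operators of `ιᵥ(x)` and `ι_w(y)` (`v, w ∤ 𝔫`, `x ∈ GL_n(K_v)`, `y ∈ GL_n(K_w)`) on
`H^q(S_{K_f(𝔫)}, Ẽ_λ(k))` commute**: two different places are orthogonal
(`TwistedQuotient.heckeEnd_comm_of_orthogonal`), and at one place the spherical Hecke algebra is
commutative by Gelfand's trick with the transpose and the Cartan decomposition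
(`ArithmeticQuotient.heckeFun_comm_of_antiInvolution`, `exists_glTranspose_eq_mul_mul_adicCompletion`).
[cite: Bump1997, Thm. 4.6.1] -/
theorem heckeOp_ofLocal_comm {𝔫 : Ideal (𝓞 K)} (h𝔫 : 𝔫 ≠ 0) (lam : (K →+* k) → Fin n → ℤ)
    (q : ℕ) {v w : HeightOneSpectrum (𝓞 K)} (hv : ¬ v.asIdeal ∣ 𝔫) (hw : ¬ w.asIdeal ∣ 𝔫)
    (x : GL (Fin n) (v.adicCompletion K)) (y : GL (Fin n) (w.adicCompletion K)) :
    heckeOp k n K 𝔫 lam q (ofLocal n K v x) * heckeOp k n K 𝔫 lam q (ofLocal n K w y) =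
      heckeOp k n K 𝔫 lam q (ofLocal n K w y) * heckeOp k n K 𝔫 lam q (ofLocal n K v x) := by
  refine LinearMap.ext fun c => ?_
  rw [Module.End.mul_apply, Module.End.mul_apply]
  by_cases hvw : v = w
  · subst hvw
    exact TwistedQuotient.heckeEnd_comm_of_heckeFun_comm _ _ _
      (ArithmeticQuotient.heckeFun_comm_of_antiInvolution k _ (isUnramifiedLevel_level n K h𝔫 hv)
        (glTranspose (Fin n)) (fun κ hκ => glTranspose_mem_valuedCongruenceSubgroup hκ)
        glTranspose_glTranspose (exists_glTranspose_eq_mul_mul_adicCompletion v (Fin n)) x y) q c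
  · exact TwistedQuotient.heckeEnd_comm_of_orthogonal _ _ _ (isUnramifiedLevel_level n K h𝔫 hv)
      (isUnramifiedLevel_level n K h𝔫 hw) (fun g => localComponent_ofLocal_of_ne (Ne.symm hvw) g)
      x y q c

/-- **The unramified Hecke operators `T_{v,i}`, `T_{w,j}` (`v, w ∤ 𝔫`, any `i, j : ℕ`) on
`H^q(S_{K_f(𝔫)}, Ẽ_λ(k))` commute** (`t_{v,i} = ιᵥ(diag(ϖ_v,…,ϖ_v,1,…,1))`,
`BigHeckeGLn.heckeElement_eq_ofLocal`, and `heckeOp_ofLocal_comm`): "these operators pairwise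
commute". [cite: GeeNewton2020, §2.1.1] -/
theorem heckeT_comm {𝔫 : Ideal (𝓞 K)} (h𝔫 : 𝔫 ≠ 0) (lam : (K →+* k) → Fin n → ℤ) (q : ℕ)
    {v w : HeightOneSpectrum (𝓞 K)} (hv : ¬ v.asIdeal ∣ 𝔫) (hw : ¬ w.asIdeal ∣ 𝔫) (i j : ℕ) :
    heckeT k n K 𝔫 lam q v i * heckeT k n K 𝔫 lam q w j =
      heckeT k n K 𝔫 lam q w j * heckeT k n K 𝔫 lam q v i := by
  dsimp only [heckeT]
  rw [heckeElement_eq_ofLocal v i, heckeElement_eq_ofLocal w j]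
  exact heckeOp_ofLocal_comm k n K h𝔫 lam q hv hw _ _

/-- `Commute` form of `heckeT_comm`: `T_{v,i}` and `T_{w,j}` commute for `v, w ∤ 𝔫` (so the
`k`-subalgebra of `End_k H^q(S_{K_f(𝔫)}, Ẽ_λ(k))` generated by the unramified `T_{v,i}` is commutative,
Mathlib `Algebra.isMulCommutative_adjoin` / `Algebra.commute_of_mem_adjoin_of_forall_mem_commute`).
[cite: GeeNewton2020, §2.1.1] -/
theorem commute_heckeT {𝔫 : Ideal (𝓞 K)} (h𝔫 : 𝔫 ≠ 0) (lam : (K →+* k) → Fin n → ℤ) (q : ℕ)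
    {v w : HeightOneSpectrum (𝓞 K)} (hv : ¬ v.asIdeal ∣ 𝔫) (hw : ¬ w.asIdeal ∣ 𝔫) (i j : ℕ) :
    Commute (heckeT k n K 𝔫 lam q v i) (heckeT k n K 𝔫 lam q w j) :=
  heckeT_comm k n K h𝔫 lam q hv hw i j

end ResGLnCohomology

end Literature.NumberTheory.Automorphic

end
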